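import Mathlib
import Summits.PneNP.PneNP.Theorems.OverlapGapAlgebraSolvableImpliesStableSectionRerandomize
import Summits.PneNP.PneNP.Theorems.OverlapGapAlgebraSolvableImpliesStableSectionUnitClauseMute
import Summits.PneNP.PneNP.Theorems.OverlapGapAlgebraSolvableImpliesStableSectionUnitClauseCount

/-!
# PneNP / OverlapGapAlgebra — crux `SolvableImpliesStableSection` (stmt-PneNP-2463):
# the UNIT CLAUSE block (7/·) — first moment, the one-clause step

Support for crux `stmt-PneNP-2463` (`Summit.PneNP.PneNP.Theses.OverlapGapAlgebra.SolvableImpliesStableSection`),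
registered stub `stub_lowDensity` (child G).  The deferred-decision bound for ONE clause: summed over
all instances `Φ`, the indicator that the non-muted clause `i` is unit at round `t + 1` of the
unit-clause dynamics with muted set `S` is at most `(2n)^{-k}` times the number of unit-like contents
against the trajectory in which `i` is muted too — a trajectory that does not read the content of `i`
(`sissU_indep`), agrees with the original one up to the unit round (`sissU_agree_insert_of_unit`), and
against which "unit at round `t + 1`" means: one slot unset, the others false, one of them set during
round `t` (`sissU_unit_succ_new`).  Counting these contents (`sissU_card_unitlike_le`):
`(2n)^k · Σ_Φ 1[i unit at t+1] ≤ (k² - k) · Σ_Φ 2·U·New·Set^{k-2}` with `U`, `Set` the numbers of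
unset / set variables at round `t + 1` and `New` the number of variables set during round `t`, all in
the doubly-muted dynamics.

* `sissU_unit_indicator_le` — pointwise: unit at `t + 1` (muted `S`) ⇒ unit-like against `insert i S`;
* `sissU_sum_unit_indicator_le` — the summed, re-randomised count.
All objects are hypotheses; no definitions; axioms `propext`, `Classical.choice`, `Quot.sound`.
-/

set_option linter.dupNamespace false -- `Summit.PneNP.PneNP.…`: summit = sub-problem (D-0017)

namespace Summit.PneNP.PneNP.Theorems

open Finset
open scoped Classical

section FMStep

variable {m k n : ℕ} {R : ℕ}
  (st : Finset (Fin m) → ℕ → (Fin m → Fin k → Fin n × Bool) → Fin n → Option Bool)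
  (dm : Finset (Fin m) → ℕ → (Fin m → Fin k → Fin n × Bool) → Fin n → Bool)
  (h0 : ∀ (S : Finset (Fin m)) (Φ : Fin m → Fin k → Fin n × Bool) (v : Fin n), st S 0 Φ v = none)
  (hstep : ∀ (S : Finset (Fin m)) (t : ℕ) (Φ : Fin m → Fin k → Fin n × Bool) (v : Fin n),
    st S (t + 1) Φ v =
      if st S t Φ v = none then
        (if ∃ i : Fin m, i ∉ S ∧ ∃ j : Fin k, (Φ i j).1 = v ∧ ∀ j' : Fin k, j' ≠ j →
            st S t Φ (Φ i j').1 ≠ none ∧ st S t Φ (Φ i j').1 ≠ some (Φ i j').2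
          then some (dm S t Φ v)
          else if (v : ℕ) * R / n = t then some true else none)
      else st S t Φ v)
  (hdm : ∀ (S : Finset (Fin m)) (t : ℕ) (Φ : Fin m → Fin k → Fin n × Bool) (v : Fin n) (i : Fin m)
    (j : Fin k), i ∉ S → (Φ i j).1 = v → st S t Φ v = none →
    (∀ j' : Fin k, j' ≠ j → st S t Φ (Φ i j').1 ≠ none ∧ st S t Φ (Φ i j').1 ≠ some (Φ i j').2) →
    (∀ i' : Fin m, i' ∉ S → (∃ j₁ : Fin k, (Φ i' j₁).1 = v ∧ ∀ j' : Fin k, j' ≠ j₁ →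
      st S t Φ (Φ i' j').1 ≠ none ∧ st S t Φ (Φ i' j').1 ≠ some (Φ i' j').2) → i ≤ i') →
    dm S t Φ v = (Φ i j).2)

/-- **Unit-like contents, sharp slot-pair count** (the `k² - k` ordered pairs of distinct slots;
restated here from `…UnitClauseCount` for the first-moment step, where the constant is the threshold). -/
theorem sissU_card_unitlike_sharp (A B C : Finset (Fin n × Bool)) :
    ((univ : Finset (Fin k → Fin n × Bool)).filter fun x => ∃ j : Fin k, x j ∈ A ∧
        (∀ j'' : Fin k, j'' ≠ j → x j'' ∈ C) ∧ ∃ j' : Fin k, j' ≠ j ∧ x j' ∈ B).card ≤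
      (k * k - k) * (A.card * B.card * C.card ^ (k - 2)) := by
  calc ((univ : Finset (Fin k → Fin n × Bool)).filter fun x => ∃ j : Fin k, x j ∈ A ∧
        (∀ j'' : Fin k, j'' ≠ j → x j'' ∈ C) ∧ ∃ j' : Fin k, j' ≠ j ∧ x j' ∈ B).card
      ≤ ((univ : Finset (Fin k)).offDiag.biUnion fun p =>
          Fintype.piFinset fun j'' : Fin k => if j'' = p.1 then A else if j'' = p.2 then B else C).card := by
        refine card_le_card fun x hx => ?_
        rw [mem_filter] at hx
        obtain ⟨-, j, hjA, hC, j', hj'j, hj'B⟩ := hx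
        rw [mem_biUnion]
        refine ⟨(j, j'), by rw [mem_offDiag]; exact ⟨mem_univ _, mem_univ _, hj'j.symm⟩, ?_⟩
        rw [Fintype.mem_piFinset]
        intro j''
        dsimp only
        split_ifs with h1 h2
        · rw [h1]; exact hjA
        · rw [h2]; exact hj'B
        · exact hC j'' h1
    _ ≤ ∑ p ∈ (univ : Finset (Fin k)).offDiag,
          (Fintype.piFinset fun j'' : Fin k => if j'' = p.1 then A else if j'' = p.2 then B else C).card :=
        card_biUnion_le
    _ = ∑ p ∈ (univ : Finset (Fin k)).offDiag, A.card * B.card * C.card ^ (k - 2) := by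
        refine sum_congr rfl fun p hp => ?_
        rw [mem_offDiag] at hp
        exact sissU_card_pi_two_slots p.1 p.2 hp.2.2 A B C
    _ = (k * k - k) * (A.card * B.card * C.card ^ (k - 2)) := by
        rw [sum_const, smul_eq_mul, offDiag_card, card_univ, Fintype.card_fin]

/-- **False literals inject into their variables.** If every literal of `B` sits on a variable of `V`
that is set (in `σ`) to the opposite value, then `|B| ≤ |V|`. -/
theorem sissU_card_falseLit_le (σ : Fin n → Option Bool) (B : Finset (Fin n × Bool)) (V : Finset (Fin n))
    (hB : ∀ ℓ ∈ B, ℓ.1 ∈ V ∧ σ ℓ.1 ≠ none ∧ σ ℓ.1 ≠ some ℓ.2) : B.card ≤ V.card := by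
  refine card_le_card_of_injOn (fun ℓ => ℓ.1) (fun ℓ hℓ => (hB ℓ hℓ).1) ?_
  rintro ⟨w, b⟩ hℓ ⟨w', b'⟩ hℓ' (hww' : w = w')
  subst hww'
  obtain ⟨-, hne, h1⟩ := hB _ hℓ
  obtain ⟨-, -, h2⟩ := hB _ hℓ'
  obtain ⟨b₀, hb₀⟩ := Option.ne_none_iff_exists'.mp hne
  dsimp only at h1 h2
  rw [hb₀] at h1 h2
  have e1 : b₀ ≠ b := fun e => h1 (by rw [e])
  have e2 : b₀ ≠ b' := fun e => h2 (by rw [e])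
  cases b <;> cases b' <;> cases b₀ <;> first | rfl | exact absurd rfl e1 | exact absurd rfl e2

include h0 hstep hdm in
/-- **Unit at round `t + 1` ⇒ unit-like against the own muting.** If `i ∉ S` is unit at round `t + 1`
(muted set `S`), then against the states of the dynamics with muted set `insert i S`: one slot of `i`
is unset at round `t + 1`, every other slot is set and false at round `t + 1`, and some other slot was
still unset at round `t`. -/
theorem sissU_unit_indicator_le (S : Finset (Fin m)) (t : ℕ) (Φ : Fin m → Fin k → Fin n × Bool)
    (i : Fin m) (hi : i ∉ S)
    (hu : ∃ j : Fin k, st S (t + 1) Φ (Φ i j).1 = none ∧ ∀ j' : Fin k, j' ≠ j →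
      st S (t + 1) Φ (Φ i j').1 ≠ none ∧ st S (t + 1) Φ (Φ i j').1 ≠ some (Φ i j').2) :
    ∃ j : Fin k, st (insert i S) (t + 1) Φ (Φ i j).1 = none ∧ (∀ j'' : Fin k, j'' ≠ j →
      st (insert i S) (t + 1) Φ (Φ i j'').1 ≠ none ∧ st (insert i S) (t + 1) Φ (Φ i j'').1 ≠ some (Φ i j'').2) ∧
      ∃ j' : Fin k, j' ≠ j ∧ st (insert i S) t Φ (Φ i j').1 = none := by
  obtain ⟨j, hv, hrest⟩ := hu
  have hagree := sissU_agree_insert_of_unit st dm h0 hstep hdm S Φ i hi (t + 1) (Φ i j).1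
    ⟨j, rfl, hv, hrest⟩
  obtain ⟨j', hj'j, hj't, -⟩ := sissU_unit_succ_new st dm hstep S t Φ i hi (Φ i j).1 j rfl hv hrest
  refine ⟨j, by rw [← hagree (t + 1) le_rfl]; exact hv, fun j'' hj'' => ?_, j', hj'j, ?_⟩
  · rw [← hagree (t + 1) le_rfl]
    exact hrest j'' hj''
  · rw [← hagree t (Nat.le_succ t)]
    exact hj't

include h0 hstep hdm in
/-- **The one-clause first-moment step.** For `i ∉ S`:
`#contents · Σ_Φ 1[i unit at round t+1 (muted S)] ≤ (k² - k) · Σ_Φ 2·U_Φ·New_Φ·Set_Φ^{k-2}`, where, in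
the dynamics with muted set `insert i S`, `U_Φ` / `Set_Φ` count the unset / set variables at round
`t + 1` and `New_Φ` the variables set during round `t`. -/
theorem sissU_sum_unit_indicator_le (S : Finset (Fin m)) (t : ℕ) (i : Fin m) (hi : i ∉ S) :
    (Fintype.card (Fin k → Fin n × Bool) : ℝ) *
      ∑ Φ : Fin m → Fin k → Fin n × Bool,
        (if ∃ j : Fin k, st S (t + 1) Φ (Φ i j).1 = none ∧ ∀ j' : Fin k, j' ≠ j →
            st S (t + 1) Φ (Φ i j').1 ≠ none ∧ st S (t + 1) Φ (Φ i j').1 ≠ some (Φ i j').2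
          then (1 : ℝ) else 0)
      ≤ ∑ Φ : Fin m → Fin k → Fin n × Bool, ((k * k - k : ℕ) : ℝ) *
          (((2 * ((univ : Finset (Fin n)).filter fun w => st (insert i S) (t + 1) Φ w = none).card) *
           ((univ : Finset (Fin n)).filter fun w =>
              st (insert i S) t Φ w = none ∧ st (insert i S) (t + 1) Φ w ≠ none).card *
           ((univ : Finset (Fin n)).filter fun w => st (insert i S) (t + 1) Φ w ≠ none).card ^ (k - 2) : ℕ) : ℝ) := by
  -- re-randomise the content of clause `i` against the doubly-muted trajectory
  have hiS : i ∈ insert i S := mem_insert_self i S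
  set Rst : (Fin m → Fin k → Fin n × Bool) → ℕ → Fin n → Option Bool :=
    fun Φ t' w => st (insert i S) t' Φ w with hRst
  have hR : ∀ (Φ : Fin m → Fin k → Fin n × Bool) (c : Fin k → Fin n × Bool),
      Rst (Function.update Φ i c) = Rst Φ := by
    intro Φ c
    funext t' w
    exact sissU_indep st dm h0 hstep hdm (insert i S) i hiS Φ c t' w
  set h : (Fin k → Fin n × Bool) → (ℕ → Fin n → Option Bool) → ℝ := fun x r =>
    if ∃ j : Fin k, r (t + 1) (x j).1 = none ∧ (∀ j'' : Fin k, j'' ≠ j →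
        r (t + 1) (x j'').1 ≠ none ∧ r (t + 1) (x j'').1 ≠ some (x j'').2) ∧
        ∃ j' : Fin k, j' ≠ j ∧ r t (x j').1 = none then (1 : ℝ) else 0 with hh
  have hrr := Summit.PneNP.PneNP.Cruxes.SolvableImpliesStableSection.Sketch.stub_rerandomize i Rst hR h
  -- pointwise: the unit indicator is at most `h (Φ i) (Rst Φ)`
  have hpt : ∀ Φ : Fin m → Fin k → Fin n × Bool,
      (if ∃ j : Fin k, st S (t + 1) Φ (Φ i j).1 = none ∧ ∀ j' : Fin k, j' ≠ j →
          st S (t + 1) Φ (Φ i j').1 ≠ none ∧ st S (t + 1) Φ (Φ i j').1 ≠ some (Φ i j').2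
        then (1 : ℝ) else 0) ≤ h (Φ i) (Rst Φ) := by
    intro Φ
    by_cases h2 : ∃ j : Fin k, st (insert i S) (t + 1) Φ (Φ i j).1 = none ∧ (∀ j'' : Fin k, j'' ≠ j →
        st (insert i S) (t + 1) Φ (Φ i j'').1 ≠ none ∧ st (insert i S) (t + 1) Φ (Φ i j'').1 ≠ some (Φ i j'').2) ∧
        ∃ j' : Fin k, j' ≠ j ∧ st (insert i S) t Φ (Φ i j').1 = none
    · have hh1 : h (Φ i) (Rst Φ) = 1 := by rw [hh]; exact if_pos h2
      rw [hh1]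
      split_ifs
      · exact le_rfl
      · exact zero_le_one
    · have hh0 : h (Φ i) (Rst Φ) = 0 := by rw [hh]; exact if_neg h2
      rw [hh0]
      have h1 : ¬ ∃ j : Fin k, st S (t + 1) Φ (Φ i j).1 = none ∧ ∀ j' : Fin k, j' ≠ j →
          st S (t + 1) Φ (Φ i j').1 ≠ none ∧ st S (t + 1) Φ (Φ i j').1 ≠ some (Φ i j').2 :=
        fun h1 => h2 (sissU_unit_indicator_le st dm h0 hstep hdm S t Φ i hi h1)
      rw [if_neg h1]
  -- the count of unit-like contents against a frozen trajectory
  have hcount : ∀ Φ : Fin m → Fin k → Fin n × Bool, ∑ x : Fin k → Fin n × Bool, h x (Rst Φ) ≤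
      ((k * k - k : ℕ) : ℝ) *
        (((2 * ((univ : Finset (Fin n)).filter fun w => st (insert i S) (t + 1) Φ w = none).card) *
         ((univ : Finset (Fin n)).filter fun w =>
            st (insert i S) t Φ w = none ∧ st (insert i S) (t + 1) Φ w ≠ none).card *
         ((univ : Finset (Fin n)).filter fun w => st (insert i S) (t + 1) Φ w ≠ none).card ^ (k - 2) : ℕ) : ℝ) := by
    intro Φ
    -- the literal sets
    set A : Finset (Fin n × Bool) := univ.filter fun ℓ =>
      ℓ.1 ∈ (univ : Finset (Fin n)).filter fun w => st (insert i S) (t + 1) Φ w = none with hA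
    set B : Finset (Fin n × Bool) := univ.filter fun ℓ => st (insert i S) t Φ ℓ.1 = none ∧
      st (insert i S) (t + 1) Φ ℓ.1 ≠ none ∧ st (insert i S) (t + 1) Φ ℓ.1 ≠ some ℓ.2 with hB
    set C : Finset (Fin n × Bool) := univ.filter fun ℓ =>
      st (insert i S) (t + 1) Φ ℓ.1 ≠ none ∧ st (insert i S) (t + 1) Φ ℓ.1 ≠ some ℓ.2 with hC
    have hsum : ∑ x : Fin k → Fin n × Bool, h x (Rst Φ) =
        (((univ : Finset (Fin k → Fin n × Bool)).filter fun x => ∃ j : Fin k,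
          Rst Φ (t + 1) (x j).1 = none ∧ (∀ j'' : Fin k, j'' ≠ j →
            Rst Φ (t + 1) (x j'').1 ≠ none ∧ Rst Φ (t + 1) (x j'').1 ≠ some (x j'').2) ∧
            ∃ j' : Fin k, j' ≠ j ∧ Rst Φ t (x j').1 = none).card : ℝ) := by
      rw [hh]
      simp only [sum_boole]
    have hsub : ((univ : Finset (Fin k → Fin n × Bool)).filter fun x => ∃ j : Fin k,
          Rst Φ (t + 1) (x j).1 = none ∧ (∀ j'' : Fin k, j'' ≠ j →
            Rst Φ (t + 1) (x j'').1 ≠ none ∧ Rst Φ (t + 1) (x j'').1 ≠ some (x j'').2) ∧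
            ∃ j' : Fin k, j' ≠ j ∧ Rst Φ t (x j').1 = none) ⊆
        (univ : Finset (Fin k → Fin n × Bool)).filter fun x => ∃ j : Fin k, x j ∈ A ∧
          (∀ j'' : Fin k, j'' ≠ j → x j'' ∈ C) ∧ ∃ j' : Fin k, j' ≠ j ∧ x j' ∈ B := by
      intro x hx
      simp only [mem_filter, mem_univ, true_and] at hx ⊢
      obtain ⟨j, hj, hC', j', hj'j, hj'⟩ := hx
      refine ⟨j, ?_, fun j'' hj'' => ?_, j', hj'j, ?_⟩
      · rw [hA]; simp only [mem_filter, mem_univ, true_and]; exact hj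
      · rw [hC]; simp only [mem_filter, mem_univ, true_and]; exact hC' j'' hj''
      · rw [hB]; simp only [mem_filter, mem_univ, true_and]; exact ⟨hj', hC' j' hj'j⟩
    have hAcard : A.card = 2 * ((univ : Finset (Fin n)).filter fun w => st (insert i S) (t + 1) Φ w = none).card := by
      rw [hA]; exact sissU_card_lit_on _
    have hCcard : C.card ≤ ((univ : Finset (Fin n)).filter fun w => st (insert i S) (t + 1) Φ w ≠ none).card := by
      refine sissU_card_falseLit_le (st (insert i S) (t + 1) Φ) C _ fun ℓ hℓ => ?_
      rw [hC, mem_filter] at hℓ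
      exact ⟨by rw [mem_filter]; exact ⟨mem_univ _, hℓ.2.1⟩, hℓ.2.1, hℓ.2.2⟩
    have hBcard : B.card ≤ ((univ : Finset (Fin n)).filter fun w =>
        st (insert i S) t Φ w = none ∧ st (insert i S) (t + 1) Φ w ≠ none).card := by
      refine sissU_card_falseLit_le (st (insert i S) (t + 1) Φ) B _ fun ℓ hℓ => ?_
      rw [hB, mem_filter] at hℓ
      exact ⟨by rw [mem_filter]; exact ⟨mem_univ _, hℓ.2.1, hℓ.2.2.1⟩, hℓ.2.2.1, hℓ.2.2.2⟩
    rw [hsum]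
    calc (((univ : Finset (Fin k → Fin n × Bool)).filter fun x => ∃ j : Fin k,
          Rst Φ (t + 1) (x j).1 = none ∧ (∀ j'' : Fin k, j'' ≠ j →
            Rst Φ (t + 1) (x j'').1 ≠ none ∧ Rst Φ (t + 1) (x j'').1 ≠ some (x j'').2) ∧
            ∃ j' : Fin k, j' ≠ j ∧ Rst Φ t (x j').1 = none).card : ℝ)
        ≤ (((univ : Finset (Fin k → Fin n × Bool)).filter fun x => ∃ j : Fin k, x j ∈ A ∧
          (∀ j'' : Fin k, j'' ≠ j → x j'' ∈ C) ∧ ∃ j' : Fin k, j' ≠ j ∧ x j' ∈ B).card : ℝ) := by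
          exact_mod_cast card_le_card hsub
      _ ≤ ((k * k - k : ℕ) : ℝ) * ((A.card * B.card * C.card ^ (k - 2) : ℕ) : ℝ) := by
          have := sissU_card_unitlike_sharp (k := k) A B C
          exact_mod_cast this
      _ ≤ ((k * k - k : ℕ) : ℝ) *
          (((2 * ((univ : Finset (Fin n)).filter fun w => st (insert i S) (t + 1) Φ w = none).card) *
           ((univ : Finset (Fin n)).filter fun w =>
              st (insert i S) t Φ w = none ∧ st (insert i S) (t + 1) Φ w ≠ none).card *
           ((univ : Finset (Fin n)).filter fun w => st (insert i S) (t + 1) Φ w ≠ none).card ^ (k - 2) : ℕ) : ℝ) := by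
          rw [← hAcard]
          have hmono : A.card * B.card * C.card ^ (k - 2) ≤ A.card *
              ((univ : Finset (Fin n)).filter fun w =>
                st (insert i S) t Φ w = none ∧ st (insert i S) (t + 1) Φ w ≠ none).card *
              ((univ : Finset (Fin n)).filter fun w => st (insert i S) (t + 1) Φ w ≠ none).card ^ (k - 2) :=
            Nat.mul_le_mul (Nat.mul_le_mul_left _ hBcard) (Nat.pow_le_pow_left hCcard _)
          exact mul_le_mul_of_nonneg_left (by exact_mod_cast hmono) (Nat.cast_nonneg _)
  -- assemble
  calc (Fintype.card (Fin k → Fin n × Bool) : ℝ) *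
        ∑ Φ : Fin m → Fin k → Fin n × Bool,
          (if ∃ j : Fin k, st S (t + 1) Φ (Φ i j).1 = none ∧ ∀ j' : Fin k, j' ≠ j →
              st S (t + 1) Φ (Φ i j').1 ≠ none ∧ st S (t + 1) Φ (Φ i j').1 ≠ some (Φ i j').2
            then (1 : ℝ) else 0)
      ≤ (Fintype.card (Fin k → Fin n × Bool) : ℝ) * ∑ Φ : Fin m → Fin k → Fin n × Bool, h (Φ i) (Rst Φ) :=
        mul_le_mul_of_nonneg_left (sum_le_sum fun Φ _ => hpt Φ) (Nat.cast_nonneg _)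
    _ = ∑ Φ : Fin m → Fin k → Fin n × Bool, ∑ x : Fin k → Fin n × Bool, h x (Rst Φ) := hrr
    _ ≤ _ := sum_le_sum fun Φ _ => hcount Φ

end FMStep

end Summit.PneNP.PneNP.Theorems
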